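import Summits.AtomisticToContinuum.FouriersLaw.Theses.EmbeddedDrudeMourre
import Summits.AtomisticToContinuum.FouriersLaw.Theorems.EmbeddedDrudeMourreNessUniqueApproximation
import Summits.AtomisticToContinuum.FouriersLaw.Theorems.EmbeddedDrudeMourreNessUniqueDuhamel
import Literature.MathematicalPhysics.KineticTheory.LangevinSemigroupProofs

/-!
# Uniqueness of the weak steady state of the pinned anharmonic chain (`NessUnique`), proved

Closes item `stmt-AtomisticToContinuum-0741` — the decl `NessUnique` of the route
`Summits/AtomisticToContinuum/FouriersLaw/Theses/EmbeddedDrudeMourre` (shared verbatim by the Fourier routes):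
for `pinnedChain ω₂ lam β γ` (all parameters positive), every `N` and all `T_L, T_R > 0`, any two measures in the
weak Fokker–Planck class `OscillatorChain.IsSteadyState` (probability, `∫ L f dμ = 0` for `f ∈ C_c^∞`, bond
currents integrable) coincide (`nessUnique_proof`).

* `withDensity_bind_langevinKernel_of_revGenerator` — **the Fokker–Planck identification**: for a chain with
  smooth confining potentials, `N ≥ 1`, polynomial volume growth of the energy sublevel sets, and a `C²`
  integrable `ρ ≥ 0` solving `L̂ρ + 2γρ = 0`, the measure `ρ dx` is invariant for the Langevin transition
  kernels, `(ρ dx).bind P_t = ρ dx` (`t ≥ 0`). Proof: Lebesgue duality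
  `dx P_t(x,dy) = e^{2γt} dy P̂_t(y,dx)` turns `(ρ dx)P_t(A)` into `e^{2γt} ∫_A P̂_t ρ`; for the truncations
  `f_n ∈ C²_c` (`0 ≤ f_n ≤ ρ`, `f_n → ρ`, defect `‖E_n‖₁ → 0`) the integrated Duhamel bound gives
  `∫ |e^{2γt} P̂_t f_n - f_n| dy → 0`, and Fatou's lemma (twice) yields `e^{2γt} ∫_A P̂_t ρ ≤ ∫_A ρ`, i.e.
  `(ρ dx) P_t ≤ ρ dx` setwise; equality follows from conservation of mass.
* `nessUnique_proof` — `N = 0`: phase space is a point. `N ≥ 1`: a weak steady state is a finite weakly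
  stationary measure, hence has a smooth density `ρ` (Hörmander's theorem, proved in the tree:
  `CuneoEckmannHairerReyBellet2018_smoothDensity_of_hormander hormander1967_thm11_proof`); integration by parts
  makes `ρ` a pointwise solution of `L̂ρ + 2γρ = 0` (`revGenerator_add_eq_zero_of_weak`), so `μ = ρ dx` is an
  invariant probability measure of `pinnedChainSemigroup` (`pinnedChain_isInvariant_of_isSteadyState`); by
  Cuneo–Eckmann–Hairer–Rey-Bellet 2018, Thm 2.13 (1) (uniqueness of the invariant probability measure, proved in
  the tree as `pinnedChainSemigroup_ergodic`) any two weak steady states are equal. With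
  `pinnedChain_exists_isSteadyState` this is clause (i) of `FouriersLawFor` for the pinned chain.
-/

noncomputable section

open MeasureTheory ProbabilityTheory Filter Topology Set
open scoped NNReal ENNReal ContDiff

namespace Summit.AtomisticToContinuum.FouriersLaw.Theorems.NessUnique

open Literature.MathematicalPhysics.KineticTheory.HeatConduction
open Literature.MathematicalPhysics.KineticTheory Literature.Probability.Process OscillatorChain
open Summit.AtomisticToContinuum.FouriersLaw.Theorems.SubdiffusiveBondHeat

variable {N : ℕ} {P : OscillatorChain}

/-- A finite measure dominated setwise by another measure of the same total mass equals it. [folklore] -/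
theorem measure_eq_of_le_of_measure_univ_eq {α : Type*} [MeasurableSpace α] {μ ν : Measure α}
    [IsFiniteMeasure μ] (hle : ∀ A, MeasurableSet A → ν A ≤ μ A) (huniv : ν Set.univ = μ Set.univ) : ν = μ := by
  refine Measure.ext fun A hA => le_antisymm (hle A hA) ?_
  have h1 := hle Aᶜ hA.compl
  have hν : ν A + ν Aᶜ = ν Set.univ := by rw [measure_add_measure_compl hA]
  have hμ : μ A + μ Aᶜ = μ Set.univ := by rw [measure_add_measure_compl hA]
  have hfin : μ Aᶜ ≠ ⊤ := measure_ne_top μ _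
  have h2 : μ A + μ Aᶜ ≤ ν A + μ Aᶜ := by
    calc μ A + μ Aᶜ = ν A + ν Aᶜ := by rw [hμ, hν, huniv]
      _ ≤ ν A + μ Aᶜ := add_le_add le_rfl h1
  exact (ENNReal.add_le_add_iff_right hfin).1 h2

section Invariance

variable (hU : ContDiff ℝ ((⊤ : ℕ∞) : WithTop ℕ∞) P.U)
  (hV : ContDiff ℝ ((⊤ : ℕ∞) : WithTop ℕ∞) P.V) (hN : 0 < N) {T_L T_R : ℝ} (hTL : 0 ≤ T_L) (hTR : 0 ≤ T_R)
  {ρ : PhaseSpace N → ℝ} (hρ : ContDiff ℝ 2 ρ) (hρ0 : ∀ x, 0 ≤ ρ x) (hρi : Integrable ρ)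
  (hpde : ∀ x, sdeGenerator (fun y => -P.drift N y) (P.bathVecL N T_L) (P.bathVecR N T_R) ρ x +
    2 * P.γ * ρ x = 0)
  (hvol : ∃ (C : ℝ) (d : ℕ), 0 ≤ C ∧ ∀ R : ℝ, 1 ≤ R →
    (volume {x : PhaseSpace N | P.hamiltonian N x ≤ 4 * R}).toReal ≤ C * R ^ d)
include hU hV hN hTL hTR hρ hρ0 hρi hpde hvol

/-- **Setwise sub-eigenvalue bound for the reversed kernels**: for `t > 0` and measurable `A`,
`∫_A (∫ ρ dP̂_t(y,·)) dy ≤ e^{-2γt} ∫_A ρ` for every set `A` (truncations, integrated Duhamel bound, Fatou twice).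
[folklore] -/
theorem setLIntegral_revKernel_density_le (hP : P.IsConfining) {t : ℝ≥0} (ht : 0 < t) (A : Set (PhaseSpace N)) :
    ∫⁻ y in A, ∫⁻ x, ENNReal.ofReal (ρ x) ∂(P.langevinRevKernel N T_L T_R t y) ≤
      ENNReal.ofReal (Real.exp (-(2 * P.γ) * t)) * ∫⁻ y in A, ENNReal.ofReal (ρ y) := by
  set κ := P.langevinRevKernel N T_L T_R with hκ
  haveI hprob : ∀ s z, IsProbabilityMeasure (κ s z) := fun s z =>
    isProbabilityMeasure_langevinRevKernel hP N T_L T_R s z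
  set c := 2 * P.γ with hc
  have hU2 : ContDiff ℝ 2 P.U := hU.of_le (by norm_cast)
  have hV2 : ContDiff ℝ 2 P.V := hV.of_le (by norm_cast)
  have hct : 0 ≤ c * t := by have := hP.γ_nonneg; have := t.coe_nonneg; positivity
  have hρc : Continuous ρ := hρ.continuous
  have hρm : Measurable fun x => ENNReal.ofReal (ρ x) := hρc.measurable.ennreal_ofReal
  -- the truncations
  have hex : ∀ n : ℕ, ∃ M R : ℝ, (n : ℝ) ≤ M ∧ (n : ℝ) ≤ R ∧ 0 < M ∧ 1 ≤ R ∧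
      ∫ x, |sdeGenerator (fun y => -P.drift N y) (P.bathVecL N T_L) (P.bathVecR N T_R)
            (fun y => smoothCutoff (P.hamiltonian N y / R) * ∫ σ in (0:ℝ)..ρ y, smoothCutoff (σ / M)) x +
          2 * P.γ * (smoothCutoff (P.hamiltonian N x / R) * ∫ σ in (0:ℝ)..ρ x, smoothCutoff (σ / M))| ≤
        1 / ((n : ℝ) + 1) := fun n =>
    exists_truncation_defect_le hU hV hN hTL hTR hρ hρ0 hρi hpde hvol hP (by positivity) n n
  choose M R hMn hRn hM0 hR1 hdef using hex
  set f : ℕ → PhaseSpace N → ℝ := fun n y =>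
    smoothCutoff (P.hamiltonian N y / R n) * ∫ σ in (0:ℝ)..ρ y, smoothCutoff (σ / M n) with hf
  have hf2 : ∀ n, ContDiff ℝ 2 (f n) := fun n => contDiff_truncation hU2 hV2 hρ (M n) (R n)
  have hfc : ∀ n, HasCompactSupport (f n) := fun n =>
    hasCompactSupport_truncation hP (M n) (by linarith [hR1 n])
  have hfI : ∀ n x, f n x ∈ Icc 0 (ρ x) := fun n x => truncation_mem_Icc hρ0 (M n) (R n) x
  have hflim : ∀ x, Tendsto (fun n => f n x) atTop (𝓝 (ρ x)) := by
    intro x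
    refine tendsto_const_nhds.congr' ?_
    obtain ⟨n₀, hn₀⟩ := exists_nat_ge (max (P.hamiltonian N x) (ρ x))
    filter_upwards [eventually_ge_atTop n₀] with n hn
    have hn' : (n₀ : ℝ) ≤ n := by exact_mod_cast hn
    have h1 : P.hamiltonian N x ≤ R n := by linarith [le_max_left (P.hamiltonian N x) (ρ x), hRn n]
    have h2 : ρ x ≤ M n := by linarith [le_max_right (P.hamiltonian N x) (ρ x), hMn n]
    simp only [hf]
    rw [energyCutoff_eq_one (by linarith [hR1 n]) h1, heightProfile_eq_self (hM0 n) h2, one_mul]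
  have hfm : ∀ n, Measurable fun x => ENNReal.ofReal (f n x) := fun n =>
    (hf2 n).continuous.measurable.ennreal_ofReal
  -- the integrated Duhamel errors tend to zero
  set D : ℕ → ℝ≥0∞ := fun n => ∫⁻ y, ENNReal.ofReal |Real.exp (c * t) * ∫ x, f n x ∂(κ t y) - f n y| with hD
  have hDle : ∀ n, D n ≤ ENNReal.ofReal (Real.exp (c * t)) * t * ENNReal.ofReal (1 / ((n:ℝ) + 1)) := by
    intro n
    refine (lintegral_abs_duhamel_le T_L T_R hP hU hV hN (hf2 n) (hfc n) t).trans ?_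
    refine mul_le_mul_right ?_ _
    have hEc : Continuous fun x => |sdeGenerator (fun z => -P.drift N z) (P.bathVecL N T_L) (P.bathVecR N T_R)
        (f n) x + 2 * P.γ * f n x| :=
      ((continuous_sdeGenerator _ _ (P.contDiff_drift hU hV N).continuous.neg (hf2 n)).add
        (continuous_const.mul (hf2 n).continuous)).abs
    have hEi : Integrable fun x => |sdeGenerator (fun z => -P.drift N z) (P.bathVecL N T_L) (P.bathVecR N T_R)
        (f n) x + 2 * P.γ * f n x| :=
      hEc.integrable_of_hasCompactSupport
        ((hasCompactSupport_sdeGenerator _ _ (hfc n)).add ((hfc n).mul_left)).abs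
    rw [← ofReal_integral_eq_lintegral_ofReal hEi (Eventually.of_forall fun x => abs_nonneg _)]
    exact ENNReal.ofReal_le_ofReal (hdef n)
  have hDlim : Tendsto D atTop (𝓝 0) := by
    have h0 : Tendsto (fun n : ℕ => ENNReal.ofReal (1 / ((n:ℝ) + 1))) atTop (𝓝 0) := by
      rw [← ENNReal.ofReal_zero]
      exact ENNReal.tendsto_ofReal tendsto_one_div_add_atTop_nhds_zero_nat
    have h1 : Tendsto (fun n : ℕ => ENNReal.ofReal (Real.exp (c * t)) * t * ENNReal.ofReal (1 / ((n:ℝ) + 1)))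
        atTop (𝓝 0) := by
      have := ENNReal.Tendsto.const_mul (a := ENNReal.ofReal (Real.exp (c * t)) * (t : ℝ≥0∞)) h0
        (Or.inr (ENNReal.mul_ne_top ENNReal.ofReal_ne_top ENNReal.coe_ne_top))
      rwa [mul_zero] at this
    exact tendsto_of_tendsto_of_tendsto_of_le_of_le tendsto_const_nhds h1 (fun n => bot_le) hDle
  -- notation for the transported functions
  set g : PhaseSpace N → ℝ≥0∞ := fun y => ∫⁻ x, ENNReal.ofReal (ρ x) ∂(κ t y) with hg
  set gn : ℕ → PhaseSpace N → ℝ≥0∞ := fun n y => ∫⁻ x, ENNReal.ofReal (f n x) ∂(κ t y) with hgn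
  have hmeas_t : ∀ {h : PhaseSpace N → ℝ≥0∞}, Measurable h → Measurable fun y => ∫⁻ x, h x ∂(κ t y) := by
    intro h hh
    have h1 := measurable_lintegral_revKernel T_L T_R hP hh
    have h2 : Measurable fun y : PhaseSpace N => (y, (t : ℝ)) := measurable_id.prodMk measurable_const
    have h3 := h1.comp h2
    simpa [Function.comp_def, Real.toNNReal_coe] using h3
  have hgn_meas : ∀ n, Measurable (gn n) := fun n => hmeas_t (hfm n)
  -- `gn = ofReal ∘ Φ_n` with the real transported truncation
  have hgn_eq : ∀ n y, gn n y = ENNReal.ofReal (∫ x, f n x ∂(κ t y)) := by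
    intro n y
    obtain ⟨Cf, hCf⟩ := (hf2 n).continuous.bounded_above_of_compact_support (hfc n)
    have hint : Integrable (f n) (κ t y) :=
      (integrable_const Cf).mono' (hf2 n).continuous.aestronglyMeasurable (Eventually.of_forall hCf)
    rw [hgn, ofReal_integral_eq_lintegral_ofReal hint (Eventually.of_forall fun x => (hfI n x).1)]
  -- pointwise: `Φ_n ≤ e^{-ct} (f_n + |e^{ct} Φ_n - f_n|)`
  have hpt : ∀ n y, gn n y ≤ ENNReal.ofReal (Real.exp (-c * t)) * ENNReal.ofReal (f n y) +
      ENNReal.ofReal (Real.exp (-c * t)) *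
        ENNReal.ofReal |Real.exp (c * t) * ∫ x, f n x ∂(κ t y) - f n y| := by
    intro n y
    rw [hgn_eq, ← mul_add, ← ENNReal.ofReal_add (hfI n y).1 (abs_nonneg _),
      ← ENNReal.ofReal_mul (Real.exp_pos _).le]
    refine ENNReal.ofReal_le_ofReal ?_
    set Φ := ∫ x, f n x ∂(κ t y)
    have hexp : Real.exp (-c * t) * Real.exp (c * t) = 1 := by rw [← Real.exp_add]; ring_nf; simp
    calc Φ = (Real.exp (-c * t) * Real.exp (c * t)) * Φ := by rw [hexp, one_mul]
      _ = Real.exp (-c * t) * (f n y + (Real.exp (c * t) * Φ - f n y)) := by ring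
      _ ≤ Real.exp (-c * t) * (f n y + |Real.exp (c * t) * Φ - f n y|) :=
          mul_le_mul_of_nonneg_left (add_le_add le_rfl (le_abs_self _)) (Real.exp_pos _).le
  -- integrate over `A`
  set J := ∫⁻ y in A, ENNReal.ofReal (ρ y) with hJ
  have hbound : ∀ n, ∫⁻ y in A, gn n y ≤ ENNReal.ofReal (Real.exp (-c * t)) * J +
      ENNReal.ofReal (Real.exp (-c * t)) * D n := by
    intro n
    have hm1 : Measurable fun y => ENNReal.ofReal (Real.exp (-c * t)) * ENNReal.ofReal (f n y) :=
      (hfm n).const_mul _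
    calc ∫⁻ y in A, gn n y
        ≤ ∫⁻ y in A, (ENNReal.ofReal (Real.exp (-c * t)) * ENNReal.ofReal (f n y) +
            ENNReal.ofReal (Real.exp (-c * t)) *
              ENNReal.ofReal |Real.exp (c * t) * ∫ x, f n x ∂(κ t y) - f n y|) := lintegral_mono (hpt n)
      _ = (ENNReal.ofReal (Real.exp (-c * t)) * ∫⁻ y in A, ENNReal.ofReal (f n y)) +
            ENNReal.ofReal (Real.exp (-c * t)) *
              ∫⁻ y in A, ENNReal.ofReal |Real.exp (c * t) * ∫ x, f n x ∂(κ t y) - f n y| := by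
          rw [lintegral_add_left hm1, lintegral_const_mul _ (hfm n), lintegral_const_mul' _ _ ENNReal.ofReal_ne_top]
      _ ≤ ENNReal.ofReal (Real.exp (-c * t)) * J + ENNReal.ofReal (Real.exp (-c * t)) * D n := by
          refine add_le_add (mul_le_mul_right (lintegral_mono fun y => ?_) _)
            (mul_le_mul_right (setLIntegral_le_lintegral A _) _)
          exact ENNReal.ofReal_le_ofReal (hfI n y).2
  -- Fatou, twice
  have hfatou1 : ∀ y, g y ≤ liminf (fun n => gn n y) atTop := by
    intro y
    have hlim : ∀ x, Tendsto (fun n => ENNReal.ofReal (f n x)) atTop (𝓝 (ENNReal.ofReal (ρ x))) := fun x =>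
      ENNReal.tendsto_ofReal (hflim x)
    calc g y = ∫⁻ x, liminf (fun n => ENNReal.ofReal (f n x)) atTop ∂(κ t y) :=
          lintegral_congr fun x => ((hlim x).liminf_eq).symm
      _ ≤ liminf (fun n => gn n y) atTop := lintegral_liminf_le hfm
  have hfatou2 : ∫⁻ y in A, g y ≤ liminf (fun n => ∫⁻ y in A, gn n y) atTop :=
    calc ∫⁻ y in A, g y ≤ ∫⁻ y in A, liminf (fun n => gn n y) atTop := lintegral_mono hfatou1
      _ ≤ liminf (fun n => ∫⁻ y in A, gn n y) atTop := lintegral_liminf_le hgn_meas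
  -- the majorants converge
  have hBlim : Tendsto (fun n => ENNReal.ofReal (Real.exp (-c * t)) * J + ENNReal.ofReal (Real.exp (-c * t)) * D n)
      atTop (𝓝 (ENNReal.ofReal (Real.exp (-c * t)) * J)) := by
    have h1 := ENNReal.Tendsto.const_mul (a := ENNReal.ofReal (Real.exp (-c * t))) hDlim (Or.inr ENNReal.ofReal_ne_top)
    rw [mul_zero] at h1
    have h2 := (tendsto_const_nhds (x := ENNReal.ofReal (Real.exp (-c * t)) * J)).add h1
    rwa [add_zero] at h2
  calc ∫⁻ y in A, g y ≤ liminf (fun n => ∫⁻ y in A, gn n y) atTop := hfatou2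
    _ ≤ liminf (fun n => ENNReal.ofReal (Real.exp (-c * t)) * J + ENNReal.ofReal (Real.exp (-c * t)) * D n) atTop :=
        liminf_le_liminf (Eventually.of_forall hbound)
    _ = ENNReal.ofReal (Real.exp (-c * t)) * J := hBlim.liminf_eq
    _ = ENNReal.ofReal (Real.exp (-(2 * P.γ) * t)) * J := by rw [hc, neg_mul]

/-- **Weakly stationary densities are sub-invariant, setwise**: for `t > 0` and measurable `A`,
`∫ ρ(x) P_t(x, A) dx ≤ ∫_A ρ` (duality + `setLIntegral_revKernel_density_le`). [folklore] -/
theorem lintegral_density_mul_langevinKernel_le (hP : P.IsConfining) {t : ℝ≥0} (ht : 0 < t) {A : Set (PhaseSpace N)}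
    (hA : MeasurableSet A) :
    ∫⁻ x, ENNReal.ofReal (ρ x) * (P.langevinKernel N T_L T_R t x) A ≤ ∫⁻ x in A, ENNReal.ofReal (ρ x) := by
  have hρm : Measurable fun x => ENNReal.ofReal (ρ x) := hρ.continuous.measurable.ennreal_ofReal
  have h1m : Measurable (A.indicator fun _ : PhaseSpace N => (1:ℝ≥0∞)) := measurable_const.indicator hA
  set Hf : PhaseSpace N × PhaseSpace N → ℝ≥0∞ :=
    fun p => ENNReal.ofReal (ρ p.1) * A.indicator (fun _ => (1:ℝ≥0∞)) p.2 with hHf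
  have hHm : Measurable Hf := (hρm.comp measurable_fst).mul (h1m.comp measurable_snd)
  have hdual := hP.lintegral_langevinKernel_duality (T_L := T_L) (T_R := T_R) hU hV hN ht hHm
  have hL : ∀ x, ∫⁻ y, Hf (x, y) ∂(P.langevinKernel N T_L T_R t x) =
      ENNReal.ofReal (ρ x) * (P.langevinKernel N T_L T_R t x) A := by
    intro x
    simp only [hHf]
    rw [lintegral_const_mul _ h1m, lintegral_indicator_const hA, one_mul]
  have hR : ∀ y, ∫⁻ x, Hf (x, y) ∂(P.langevinRevKernel N T_L T_R t y) =
      A.indicator (fun _ => (1:ℝ≥0∞)) y * ∫⁻ x, ENNReal.ofReal (ρ x) ∂(P.langevinRevKernel N T_L T_R t y) := by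
    intro y
    simp only [hHf]
    rw [lintegral_mul_const _ hρm, mul_comm]
  simp_rw [hL, hR] at hdual
  rw [hdual]
  have hind : ∫⁻ y, A.indicator (fun _ => (1:ℝ≥0∞)) y *
      ∫⁻ x, ENNReal.ofReal (ρ x) ∂(P.langevinRevKernel N T_L T_R t y) =
      ∫⁻ y in A, ∫⁻ x, ENNReal.ofReal (ρ x) ∂(P.langevinRevKernel N T_L T_R t y) := by
    rw [← lintegral_indicator hA]
    refine lintegral_congr fun y => ?_
    by_cases hy : y ∈ A
    · simp [hy]
    · simp [hy]
  rw [hind]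
  calc ENNReal.ofReal (Real.exp (2 * P.γ * t)) * ∫⁻ y in A, ∫⁻ x, ENNReal.ofReal (ρ x) ∂(P.langevinRevKernel N T_L T_R t y)
      ≤ ENNReal.ofReal (Real.exp (2 * P.γ * t)) * (ENNReal.ofReal (Real.exp (-(2 * P.γ) * t)) *
          ∫⁻ y in A, ENNReal.ofReal (ρ y)) :=
        mul_le_mul_right (setLIntegral_revKernel_density_le hU hV hN hTL hTR hρ hρ0 hρi hpde hvol hP ht A) _
    _ = ∫⁻ y in A, ENNReal.ofReal (ρ y) := by
        rw [← mul_assoc, ← ENNReal.ofReal_mul (Real.exp_pos _).le, ← Real.exp_add]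
        have : 2 * P.γ * (t:ℝ) + -(2 * P.γ) * t = 0 := by ring
        rw [this, Real.exp_zero, ENNReal.ofReal_one, one_mul]

/-- **A weakly stationary smooth density is an invariant measure of the Langevin kernels**:
`(ρ dx).bind P_t = ρ dx` for every `t ≥ 0` (setwise sub-invariance + conservation of mass).
[cite: CuneoEckmannHairerReyBellet2018, §3.1] -/
theorem withDensity_bind_langevinKernel_of_revGenerator (hP : P.IsConfining) (t : ℝ≥0) :
    (volume.withDensity fun x => ENNReal.ofReal (ρ x)).bind (P.langevinKernel N T_L T_R t) =
      volume.withDensity fun x => ENNReal.ofReal (ρ x) := by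
  set μ := volume.withDensity fun x => ENNReal.ofReal (ρ x) with hμ
  have hρm : Measurable fun x => ENNReal.ofReal (ρ x) := hρ.continuous.measurable.ennreal_ofReal
  haveI : IsFiniteMeasure μ := by
    refine ⟨?_⟩
    rw [hμ, withDensity_apply _ MeasurableSet.univ, Measure.restrict_univ,
      ← ofReal_integral_eq_lintegral_ofReal hρi (Eventually.of_forall hρ0)]
    exact ENNReal.ofReal_lt_top
  haveI : IsMarkovKernel (P.langevinKernel N T_L T_R t) := hP.isMarkovKernel_langevinKernel N T_L T_R t
  rcases eq_or_lt_of_le (show (0:ℝ≥0) ≤ t from bot_le) with ht | ht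
  · rw [← ht, hP.langevinKernel_zero N T_L T_R]
    have : (⇑(Kernel.id : Kernel (PhaseSpace N) (PhaseSpace N))) = Measure.dirac := funext fun x => Kernel.id_apply x
    rw [this, Measure.bind_dirac]
  · refine measure_eq_of_le_of_measure_univ_eq (fun A hA => ?_) ?_
    · rw [Measure.bind_apply hA (Kernel.measurable _).aemeasurable,
        lintegral_withDensity_eq_lintegral_mul₀ hρm.aemeasurable (Kernel.measurable_coe _ hA).aemeasurable,
        withDensity_apply _ hA]
      exact lintegral_density_mul_langevinKernel_le hU hV hN hTL hTR hρ hρ0 hρi hpde hvol hP ht hA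
    · rw [Measure.bind_apply MeasurableSet.univ (Kernel.measurable _).aemeasurable]
      simp

end Invariance

end Summit.AtomisticToContinuum.FouriersLaw.Theorems.NessUnique

/-! ### The pinned chain: weak steady states are invariant, hence unique -/

namespace Summit.AtomisticToContinuum.FouriersLaw.Theorems

open Literature.MathematicalPhysics.KineticTheory.HeatConduction
open Literature.MathematicalPhysics.KineticTheory Literature.Probability.Process OscillatorChain
open Summit.AtomisticToContinuum.FouriersLaw.Theorems.SubdiffusiveBondHeat
open Summit.AtomisticToContinuum.FouriersLaw.Theorems.NessUnique

/-- **Weak steady states of the pinned chain are invariant for its transition semigroup** (`N ≥ 1`): the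
Fokker–Planck identification. A probability measure `μ` with `∫ L f dμ = 0` for all `f ∈ C_c^∞` has a smooth
density `ρ` (Hörmander), `L̂ρ + 2γρ = 0` pointwise, and `μ P_t = μ` for the constructed transition kernels.
[cite: CuneoEckmannHairerReyBellet2018, Thm 2.13 and §3.1] -/
theorem pinnedChain_isInvariant_of_isSteadyState {ω₂ lam β γ : ℝ} (hω : 0 < ω₂) (hl : 0 < lam) (hβ : 0 < β)
    (hγ : 0 < γ) {N : ℕ} (hN : 0 < N) {T_L T_R : ℝ} (hL : 0 < T_L) (hR : 0 < T_R)
    {μ : Measure (PhaseSpace N)} (hμ : (pinnedChain ω₂ lam β γ).IsSteadyState N T_L T_R μ) :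
    (pinnedChainSemigroup hω hl.le hβ.le hγ.le hN hL.le hR.le).IsInvariant μ := by
  set P := pinnedChain ω₂ lam β γ with hPdef
  obtain ⟨hprob, hweak, -⟩ := hμ
  have hPc : P.IsConfining := pinnedChain_isConfining hω hl.le hβ.le hγ.le
  have hU : ContDiff ℝ ((⊤ : ℕ∞) : WithTop ℕ∞) P.U := pinnedChain_contDiff_U ω₂ lam β γ
  have hV : ContDiff ℝ ((⊤ : ℕ∞) : WithTop ℕ∞) P.V := pinnedChain_contDiff_V ω₂ lam β γ
  -- smooth density (Hörmander)
  obtain ⟨ρ, hρs, hρ0, hμρ⟩ : HasSmoothDensity μ :=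
    CuneoEckmannHairerReyBellet2018_smoothDensity_of_hormander
      Literature.Analysis.Hypoelliptic.hormander1967_thm11_proof ω₂ lam β γ hω hl.le hβ hγ N T_L T_R hN hL hR μ
      inferInstance hweak
  have hρ2 : ContDiff ℝ 2 ρ := hρs.of_le (by norm_cast)
  have hρc : Continuous ρ := hρs.continuous
  -- the density is integrable (μ is a probability measure)
  have hlin : ∫⁻ x, ENNReal.ofReal (ρ x) = μ Set.univ := by
    rw [hμρ, withDensity_apply _ MeasurableSet.univ, Measure.restrict_univ]
  have hρi : Integrable ρ := by
    refine ⟨hρc.aestronglyMeasurable, ?_⟩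
    rw [hasFiniteIntegral_iff_enorm]
    have e : ∀ x, ‖ρ x‖ₑ = ENNReal.ofReal (ρ x) := fun x => Real.enorm_eq_ofReal (hρ0 x)
    simp_rw [e, hlin]
    exact measure_lt_top μ _
  -- the weak equation against the density, and the pointwise Fokker–Planck equation
  have hweak' : ∀ φ : PhaseSpace N → ℝ, ContDiff ℝ ∞ φ → HasCompactSupport φ →
      ∫ x, P.generator N T_L T_R φ x * ρ x = 0 := by
    intro φ hφ hφc
    have h := hweak φ hφ hφc
    have e : (fun x => ENNReal.ofReal (ρ x)) = fun x => ((ρ x).toNNReal : ℝ≥0∞) := rfl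
    rw [hμρ, e, integral_withDensity_eq_integral_smul hρc.measurable.real_toNNReal] at h
    rw [← h]
    refine integral_congr_ae (Eventually.of_forall fun x => ?_)
    show P.generator N T_L T_R φ x * ρ x = (ρ x).toNNReal • P.generator N T_L T_R φ x
    rw [NNReal.smul_def, smul_eq_mul, Real.coe_toNNReal _ (hρ0 x), mul_comm]
  have hpde := revGenerator_add_eq_zero_of_weak P hU hV hN (mul_nonneg hγ.le hL.le) (mul_nonneg hγ.le hR.le)
    hρ2 hweak'
  -- polynomial volume growth of the sublevel sets
  have hvol : ∃ (C : ℝ) (d : ℕ), 0 ≤ C ∧ ∀ R : ℝ, 1 ≤ R →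
      (volume {x : PhaseSpace N | P.hamiltonian N x ≤ 4 * R}).toReal ≤ C * R ^ d := by
    obtain ⟨C, d, hC, hCE⟩ := pinnedChain_volume_sublevel_le hω hl.le hβ.le γ N
    refine ⟨C * 4 ^ d, d, by positivity, fun R hR1 => ?_⟩
    have h := hCE (4 * R) (by linarith)
    calc (volume {x : PhaseSpace N | P.hamiltonian N x ≤ 4 * R}).toReal ≤ C * (4 * R) ^ d := h
      _ = C * 4 ^ d * R ^ d := by rw [mul_pow]; ring
  -- invariance of `ρ dx` for the model-free kernels, transported to the semigroup
  intro t
  have hinv := withDensity_bind_langevinKernel_of_revGenerator hU hV hN hL.le hR.le hρ2 hρ0 hρi hpde hvol hPc t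
  show μ.bind ((pinnedChainSemigroup hω hl.le hβ.le hγ.le hN hL.le hR.le).kernel t) = μ
  rw [pinnedChainSemigroup_kernel, ← pinnedChain_langevinKernel_eq_transitionKernel N T_L T_R hω hl.le hβ.le hγ.le t,
    hμρ]
  exact hinv

/-- **NessUnique — uniqueness of the weak steady state of the pinned anharmonic chain.** For
`pinnedChain ω₂ lam β γ` (`ω₂, lam, β, γ > 0`), every `N` and all `T_L, T_R > 0`, any two probability measures in
the weak Fokker–Planck class `IsSteadyState` coincide: both are invariant probability measures of the transition
semigroup (`pinnedChain_isInvariant_of_isSteadyState`), which has at most one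
(Cuneo–Eckmann–Hairer–Rey-Bellet 2018, Thm 2.13 (1), `pinnedChainSemigroup_ergodic`); for `N = 0` phase space is a
single point. [cite: CuneoEckmannHairerReyBellet2018, Thm 2.13] -/
theorem nessUnique_proof : Summit.AtomisticToContinuum.FouriersLaw.Theses.EmbeddedDrudeMourre.NessUnique := by
  intro ω₂ lam β γ hω hl hβ hγ N T_L T_R hL hR μ ν hμ hν
  rcases Nat.eq_zero_or_pos N with rfl | hN
  · -- `N = 0`: phase space is a point
    haveI := hμ.1
    haveI := hν.1
    refine Measure.ext fun A _ => ?_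
    rcases A.eq_empty_or_nonempty with rfl | hne
    · simp
    · rw [Subsingleton.eq_univ_of_nonempty hne, measure_univ, measure_univ]
  · haveI := hμ.1
    haveI := hν.1
    obtain ⟨huniq, -⟩ := pinnedChainSemigroup_ergodic hω hl.le hβ hγ hN hL hR
    exact huniq μ ν inferInstance inferInstance
      (pinnedChain_isInvariant_of_isSteadyState hω hl hβ hγ hN hL hR hμ)
      (pinnedChain_isInvariant_of_isSteadyState hω hl hβ hγ hN hL hR hν)

end Summit.AtomisticToContinuum.FouriersLaw.Theorems

end
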